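import Summits.CriticalPhenomena.PercolationContinuityZ3.Theorems.PercNearOneGluingNoHeavyLowerTailHybridThreePointLBPointwise
import Summits.CriticalPhenomena.PercolationContinuityZ3.Theorems.PercNearOneGluingNoHeavyLowerTailFibreSwitchingSHK3Cert
import Mathlib.Tactic.Ring
import Mathlib.Tactic.Linarith
import HarnessLib

/-!
# `NoHeavyLowerTail` (stmt-CriticalPhenomena-4575) — THEOREM `M(hybrid E₃)` (three-copy FIBRE / comb positivity of Sahi's
# `E₃({P₁ ≁ c}, {c ≁ P₃}, {P₁ ≁ P₃′})`, `P₃ ⊆ P₃′`, on every finite graph), I: fibre bijections and the unswitched table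

Support file (new-inequality factory seat `prim-ineq-gen-1`, gen 6; `--supports stmt-CriticalPhenomena-4575`).  No named facts,
no sorries.  This is the group / hybrid analogue of `…FibreSwitchingSHK3Cert` (which is the special case `P₁ = {b}`,
`P₃ = P₃′ = {a}`): prim-cert-2's formalisation `HybridThreePointLB` (source prim-ineq-gen-8, THEOREM-HYBRID-3PTLB) proves
`E₃ ≥ 0` for the three group-separation events at the level of LAWS by four group switchings `gphi1 … gphi4` and a
pointwise certificate `HybridThreePointLB.cert ≤ 0`.  The switchings are two-region splicings, hence bijections of every
three-copy fibre (`sum_fibre_gphi1 … 4`, via `FibreSHK3.sum_fibre_comp_splice3`), so the certificate's fibre sum equals the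
fibre sum of the UNswitched potential `gcertU` (`sum_fibre_gcert`), a function `glamZ` of the three per-copy CODES
`codeA ∈ {0,…,7} ∖ {4}` (bit 0 = `P₁ ≁ c`, bit 1 = `c ≁ P₃`, bit 2 = `P₁ ≁ P₃′`; `codeA_cases`, `gcertU_eq`).  Part II
(`…FibreSwitchingHybridE3`) symmetrises over the copies and concludes.
-/

noncomputable section

namespace Summit.CriticalPhenomena.PercolationContinuityZ3.Theorems

namespace FibreHybridE3

open Finset Literature.Probability.Percolation Literature.Probability.Percolation.DecisionTree
open Literature.Probability.Percolation.Gladkov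
open FibreSwitching ThreePointLB HybridThreePointLB FibreSHK3
open scoped Classical

variable {V : Type*} [Fintype V] [DecidableEq V]

/-! ### The four group switchings are bijections of every fibre -/

section Switchings

variable (D : Finset (Sym2 V)) (c : V) (S' S₁ : Finset V) (k : Sym2 V → ℕ) {M : Type*} [AddCommMonoid M]
  (f : (Fin 3 → Finset (Sym2 V)) → M)

/-- `Φ₁` (explore the group `S′` in copy `0`, exchange copies `0,1` there) is a bijection of every fibre. [this work] -/
theorem sum_fibre_gphi1 : ∑ x ∈ fibre D k, f (gphi1 S' x) = ∑ x ∈ fibre D k, f x := by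
  unfold gphi1
  exact sum_fibre_comp_splice3 (selfDetermined_touch_gcl S') (fun K => Finset.disjoint_empty_left _)
    (fun _ _ _ => rfl) D k f

/-- `Φ₂` (explore the group `S₁` in copy `0`, exchange copies `0,2` there) is a bijection of every fibre. [this work] -/
theorem sum_fibre_gphi2 : ∑ x ∈ fibre D k, f (gphi2 S₁ x) = ∑ x ∈ fibre D k, f x := by
  unfold gphi2
  refine sum_fibre_comp_splice3 (fun _ _ _ => rfl) (fun K => Finset.disjoint_empty_right _)
    (fun K K' h => ?_) D k f
  rw [gcl_eq_of_agree fun e he => h e (Finset.mem_union_right _ he)]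

/-- `Φ₃` (`S′` to copy `1`, then `S₁` to copy `2`) is a bijection of every fibre. [this work] -/
theorem sum_fibre_gphi3 : ∑ x ∈ fibre D k, f (gphi3 S' S₁ x) = ∑ x ∈ fibre D k, f x := by
  unfold gphi3
  exact sum_fibre_comp_splice3 (selfDetermined_touch_gcl S') (fun K => Finset.sdiff_disjoint)
    (touch_gsdiff_congr S' S₁) D k f

/-- `Φ₄` (`{c}` to copy `2`, then `S′` to copy `1`) is a bijection of every fibre. [this work] -/
theorem sum_fibre_gphi4 : ∑ x ∈ fibre D k, f (gphi4 c S' x) = ∑ x ∈ fibre D k, f x := by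
  set σ : Equiv.Perm (Fin 3) := Equiv.swap 1 2 with hσ
  set R : Finset (Sym2 V) → Finset (Sym2 V) := fun K => touch (gcl K {c}) with hR
  set S : Finset (Sym2 V) → Finset (Sym2 V) := fun K => touch (gcl K S') \ touch (gcl K {c}) with hS
  have hphi : ∀ x, gphi4 c S' x = fun j => splice3 R S (fun i => x (σ i)) (σ j) := fun x => rfl
  calc ∑ x ∈ fibre D k, f (gphi4 c S' x)
      = ∑ x ∈ fibre D k, (fun y => f (fun j => splice3 R S y (σ j))) (fun i => x (σ i)) :=
        sum_congr rfl fun x _ => by rw [hphi]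
    _ = ∑ y ∈ fibre D k, f (fun j => splice3 R S y (σ j)) :=
        sum_fibre_comp_perm D σ k (fun y => f (fun j => splice3 R S y (σ j)))
    _ = ∑ y ∈ fibre D k, f (fun j => y (σ j)) :=
        sum_fibre_comp_splice3 (selfDetermined_touch_gcl {c}) (fun K => Finset.sdiff_disjoint)
          (touch_gsdiff_congr {c} S') D k (fun y => f (fun j => y (σ j)))
    _ = ∑ y ∈ fibre D k, f y := sum_fibre_comp_perm D σ k f

end Switchings

/-! ### The fibre sum of the certificate is the fibre sum of the unswitched potential -/

section Cert

variable (c : V) (P₁ P₃ P₃' : Finset V)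

/-- The unswitched potential of the hybrid certificate: the seven box indicators of `HybridThreePointLB.cert`, read on the
input triple itself. [this work] -/
def gcertU (x : Fin 3 → Finset (Sym2 V)) : ℝ :=
  ind (box (gconn {c} P₁ ∩ (gconn P₃' P₁)ᶜ) (gconn {c} P₁)ᶜ (gconn {c} P₃)) x
  + ind (box (gconn {c} P₃ ∩ (gconn P₃' P₁)ᶜ) (gconn {c} P₁) (gconn {c} P₃)ᶜ) x
  - ind (box ((gconn P₃' P₁)ᶜ ∩ ((gconn {c} P₁)ᶜ ∩ (gconn {c} P₃)ᶜ)) (gconn {c} P₁)ᶜ (gconn {c} P₃)ᶜ) x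
  - ind (box Set.univ ((gconn P₃' P₁)ᶜ ∩ ((gconn {c} P₁)ᶜ ∩ (gconn {c} P₃)ᶜ)) (gconn {c} P₃)) x
  - ind (box Set.univ (gconn {c} P₁) ((gconn P₃' P₁)ᶜ ∩ ((gconn {c} P₁)ᶜ ∩ (gconn {c} P₃)ᶜ))) x
  + ind (box Set.univ (gconn {c} P₁ ∩ (gconn P₃' P₁)ᶜ) ((gconn {c} P₁)ᶜ ∩ (gconn {c} P₃)ᶜ)) x
  + ind (box Set.univ ((gconn P₃' P₁)ᶜ ∩ (gconn {c} P₁)ᶜ) ((gconn {c} P₁)ᶜ ∩ (gconn {c} P₃)ᶜ)) x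

/-- **Fibrewise**, the hybrid certificate and its unswitched potential have the same sum. [this work] -/
theorem sum_fibre_gcert (D : Finset (Sym2 V)) (k : Sym2 V → ℕ) :
    ∑ x ∈ fibre D k, HybridThreePointLB.cert c P₁ P₃ P₃' x = ∑ x ∈ fibre D k, gcertU c P₁ P₃ P₃' x := by
  have h1 : ∀ E₀ E₁ E₂ : Set (Finset (Sym2 V)),
      ∑ x ∈ fibre D k, ind (box E₀ E₁ E₂) (gphi1 P₃' x) = ∑ x ∈ fibre D k, ind (box E₀ E₁ E₂) x :=
    fun E₀ E₁ E₂ => sum_fibre_gphi1 D P₃' k (ind (box E₀ E₁ E₂))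
  have h2 : ∀ E₀ E₁ E₂ : Set (Finset (Sym2 V)),
      ∑ x ∈ fibre D k, ind (box E₀ E₁ E₂) (gphi2 P₁ x) = ∑ x ∈ fibre D k, ind (box E₀ E₁ E₂) x :=
    fun E₀ E₁ E₂ => sum_fibre_gphi2 D P₁ k (ind (box E₀ E₁ E₂))
  have h3 : ∀ E₀ E₁ E₂ : Set (Finset (Sym2 V)),
      ∑ x ∈ fibre D k, ind (box E₀ E₁ E₂) (gphi3 P₃' P₁ x) = ∑ x ∈ fibre D k, ind (box E₀ E₁ E₂) x :=
    fun E₀ E₁ E₂ => sum_fibre_gphi3 D P₃' P₁ k (ind (box E₀ E₁ E₂))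
  have h4 : ∀ E₀ E₁ E₂ : Set (Finset (Sym2 V)),
      ∑ x ∈ fibre D k, ind (box E₀ E₁ E₂) (gphi4 c P₃' x) = ∑ x ∈ fibre D k, ind (box E₀ E₁ E₂) x :=
    fun E₀ E₁ E₂ => sum_fibre_gphi4 D c P₃' k (ind (box E₀ E₁ E₂))
  simp only [HybridThreePointLB.cert, gcertU, sum_add_distrib, sum_sub_distrib, h1, h2, h3, h4]

/-- The fibre sum of the unswitched potential is `≤ 0` whenever `P₃ ⊆ P₃′`. [this work] -/
theorem sum_fibre_gcertU_nonpos (hP : P₃ ⊆ P₃') (D : Finset (Sym2 V)) (k : Sym2 V → ℕ) :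
    ∑ x ∈ fibre D k, gcertU c P₁ P₃ P₃' x ≤ 0 := by
  rw [← sum_fibre_gcert]
  exact sum_nonpos fun x _ => cert_nonpos c P₁ P₃ P₃' hP x

end Cert

/-! ### The code of a configuration and the potential as a table -/

section Codes

variable (c : V) (P₁ P₃ P₃' : Finset V)

/-- The membership code of a configuration in the three DECREASING events: bit 0 = `P₁ ≁ c`, bit 1 = `c ≁ P₃`,
bit 2 = `P₁ ≁ P₃′` (value in `{0,…,7}`; the value `4` — `P₁ ~ c ~ P₃` but `P₁ ≁ P₃′` — is impossible when `P₃ ⊆ P₃′`).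
[this work] -/
def codeA (K : Finset (Sym2 V)) : ℕ :=
  if K ∈ gconn P₃' P₁ then
    (if K ∈ gconn {c} P₁ then (if K ∈ gconn {c} P₃ then 0 else 2) else (if K ∈ gconn {c} P₃ then 1 else 3))
  else
    (if K ∈ gconn {c} P₁ then (if K ∈ gconn {c} P₃ then 4 else 6) else (if K ∈ gconn {c} P₃ then 5 else 7))

omit [DecidableEq V] in
/-- The seven realizable membership patterns and their codes (`P₃ ⊆ P₃′` excludes `c ~ P₁, c ~ P₃, P₁ ≁ P₃′`). [this work] -/
theorem codeA_cases (hP : P₃ ⊆ P₃') (K : Finset (Sym2 V)) :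
    (K ∈ gconn {c} P₁ ∧ K ∈ gconn {c} P₃ ∧ K ∈ gconn P₃' P₁ ∧ codeA c P₁ P₃ P₃' K = 0) ∨
    (K ∉ gconn {c} P₁ ∧ K ∈ gconn {c} P₃ ∧ K ∈ gconn P₃' P₁ ∧ codeA c P₁ P₃ P₃' K = 1) ∨
    (K ∈ gconn {c} P₁ ∧ K ∉ gconn {c} P₃ ∧ K ∈ gconn P₃' P₁ ∧ codeA c P₁ P₃ P₃' K = 2) ∨
    (K ∉ gconn {c} P₁ ∧ K ∉ gconn {c} P₃ ∧ K ∈ gconn P₃' P₁ ∧ codeA c P₁ P₃ P₃' K = 3) ∨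
    (K ∉ gconn {c} P₁ ∧ K ∈ gconn {c} P₃ ∧ K ∉ gconn P₃' P₁ ∧ codeA c P₁ P₃ P₃' K = 5) ∨
    (K ∈ gconn {c} P₁ ∧ K ∉ gconn {c} P₃ ∧ K ∉ gconn P₃' P₁ ∧ codeA c P₁ P₃ P₃' K = 6) ∨
    (K ∉ gconn {c} P₁ ∧ K ∉ gconn {c} P₃ ∧ K ∉ gconn P₃' P₁ ∧ codeA c P₁ P₃ P₃' K = 7) := by
  have tr : K ∈ gconn {c} P₁ → K ∈ gconn {c} P₃ → K ∈ gconn P₃' P₁ := fun h1 h3 =>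
    mem_gconn_comm.1 (mem_gconn_mono_right hP (mem_gconn_comm.1 (mem_gconn_trans_vertex h1 h3)))
  unfold codeA
  by_cases h1 : K ∈ gconn {c} P₁ <;> by_cases h2 : K ∈ gconn {c} P₃ <;> by_cases h3 : K ∈ gconn P₃' P₁
  · exact Or.inl ⟨h1, h2, h3, by simp [h1, h2, h3]⟩
  · exact absurd (tr h1 h2) h3
  · exact Or.inr (Or.inr (Or.inl ⟨h1, h2, h3, by simp [h1, h2, h3]⟩))
  · exact Or.inr (Or.inr (Or.inr (Or.inr (Or.inr (Or.inl ⟨h1, h2, h3, by simp [h1, h2, h3]⟩)))))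
  · exact Or.inr (Or.inl ⟨h1, h2, h3, by simp [h1, h2, h3]⟩)
  · exact Or.inr (Or.inr (Or.inr (Or.inr (Or.inl ⟨h1, h2, h3, by simp [h1, h2, h3]⟩))))
  · exact Or.inr (Or.inr (Or.inr (Or.inl ⟨h1, h2, h3, by simp [h1, h2, h3]⟩)))
  · exact Or.inr (Or.inr (Or.inr (Or.inr (Or.inr (Or.inr ⟨h1, h2, h3, by simp [h1, h2, h3]⟩)))))

/-- Integer indicator of a finite set of codes. [this work] -/
def chiN (S : Finset ℕ) (l : ℕ) : ℤ := if l ∈ S then 1 else 0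

omit [Fintype V] [DecidableEq V] in
/-- The indicator of an event that is a union of code classes is the code indicator. [this work] -/
theorem ind_eq_chiN {cd : Finset (Sym2 V) → ℕ} {E : Set (Finset (Sym2 V))} {S : Finset ℕ}
    (h : ∀ K, K ∈ E ↔ cd K ∈ S) (K : Finset (Sym2 V)) :
    ind E K = (chiN S (cd K) : ℝ) := by
  unfold ind chiN
  rw [h K]
  split_ifs <;> simp

section Events

omit [DecidableEq V]

/-- `{c ~ P₁, P₁ ≁ P₃′}` is codes `{4, 6}`. [this work] -/
theorem mem_e1_e3c_iff (hP : P₃ ⊆ P₃') (K : Finset (Sym2 V)) :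
    K ∈ gconn {c} P₁ ∩ (gconn P₃' P₁)ᶜ ↔ codeA c P₁ P₃ P₃' K ∈ ({4, 6} : Finset ℕ) := by
  rcases codeA_cases c P₁ P₃ P₃' hP K with ⟨h1, h2, h3, hc⟩ | ⟨h1, h2, h3, hc⟩ | ⟨h1, h2, h3, hc⟩ | ⟨h1, h2, h3, hc⟩ |
    ⟨h1, h2, h3, hc⟩ | ⟨h1, h2, h3, hc⟩ | ⟨h1, h2, h3, hc⟩ <;> simp_all

/-- `{P₁ ≁ c}` is codes `{1, 3, 5, 7}`. [this work] -/
theorem mem_e1c_iff (hP : P₃ ⊆ P₃') (K : Finset (Sym2 V)) :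
    K ∈ (gconn {c} P₁)ᶜ ↔ codeA c P₁ P₃ P₃' K ∈ ({1, 3, 5, 7} : Finset ℕ) := by
  rcases codeA_cases c P₁ P₃ P₃' hP K with ⟨h1, h2, h3, hc⟩ | ⟨h1, h2, h3, hc⟩ | ⟨h1, h2, h3, hc⟩ | ⟨h1, h2, h3, hc⟩ |
    ⟨h1, h2, h3, hc⟩ | ⟨h1, h2, h3, hc⟩ | ⟨h1, h2, h3, hc⟩ <;> simp_all

/-- `{c ~ P₃}` is codes `{0, 1, 4, 5}`. [this work] -/
theorem mem_e2_iff (hP : P₃ ⊆ P₃') (K : Finset (Sym2 V)) :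
    K ∈ gconn {c} P₃ ↔ codeA c P₁ P₃ P₃' K ∈ ({0, 1, 4, 5} : Finset ℕ) := by
  rcases codeA_cases c P₁ P₃ P₃' hP K with ⟨h1, h2, h3, hc⟩ | ⟨h1, h2, h3, hc⟩ | ⟨h1, h2, h3, hc⟩ | ⟨h1, h2, h3, hc⟩ |
    ⟨h1, h2, h3, hc⟩ | ⟨h1, h2, h3, hc⟩ | ⟨h1, h2, h3, hc⟩ <;> simp_all

/-- `{c ~ P₃, P₁ ≁ P₃′}` is codes `{4, 5}`. [this work] -/
theorem mem_e2_e3c_iff (hP : P₃ ⊆ P₃') (K : Finset (Sym2 V)) :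
    K ∈ gconn {c} P₃ ∩ (gconn P₃' P₁)ᶜ ↔ codeA c P₁ P₃ P₃' K ∈ ({4, 5} : Finset ℕ) := by
  rcases codeA_cases c P₁ P₃ P₃' hP K with ⟨h1, h2, h3, hc⟩ | ⟨h1, h2, h3, hc⟩ | ⟨h1, h2, h3, hc⟩ | ⟨h1, h2, h3, hc⟩ |
    ⟨h1, h2, h3, hc⟩ | ⟨h1, h2, h3, hc⟩ | ⟨h1, h2, h3, hc⟩ <;> simp_all

/-- `{c ~ P₁}` is codes `{0, 2, 4, 6}`. [this work] -/
theorem mem_e1_iff (hP : P₃ ⊆ P₃') (K : Finset (Sym2 V)) :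
    K ∈ gconn {c} P₁ ↔ codeA c P₁ P₃ P₃' K ∈ ({0, 2, 4, 6} : Finset ℕ) := by
  rcases codeA_cases c P₁ P₃ P₃' hP K with ⟨h1, h2, h3, hc⟩ | ⟨h1, h2, h3, hc⟩ | ⟨h1, h2, h3, hc⟩ | ⟨h1, h2, h3, hc⟩ |
    ⟨h1, h2, h3, hc⟩ | ⟨h1, h2, h3, hc⟩ | ⟨h1, h2, h3, hc⟩ <;> simp_all

/-- `{c ≁ P₃}` is codes `{2, 3, 6, 7}`. [this work] -/
theorem mem_e2c_iff (hP : P₃ ⊆ P₃') (K : Finset (Sym2 V)) :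
    K ∈ (gconn {c} P₃)ᶜ ↔ codeA c P₁ P₃ P₃' K ∈ ({2, 3, 6, 7} : Finset ℕ) := by
  rcases codeA_cases c P₁ P₃ P₃' hP K with ⟨h1, h2, h3, hc⟩ | ⟨h1, h2, h3, hc⟩ | ⟨h1, h2, h3, hc⟩ | ⟨h1, h2, h3, hc⟩ |
    ⟨h1, h2, h3, hc⟩ | ⟨h1, h2, h3, hc⟩ | ⟨h1, h2, h3, hc⟩ <;> simp_all

/-- `{P₁ ≁ P₃′, P₁ ≁ c, c ≁ P₃}` is code `{7}`. [this work] -/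
theorem mem_q_iff (hP : P₃ ⊆ P₃') (K : Finset (Sym2 V)) :
    K ∈ (gconn P₃' P₁)ᶜ ∩ ((gconn {c} P₁)ᶜ ∩ (gconn {c} P₃)ᶜ) ↔ codeA c P₁ P₃ P₃' K ∈ ({7} : Finset ℕ) := by
  rcases codeA_cases c P₁ P₃ P₃' hP K with ⟨h1, h2, h3, hc⟩ | ⟨h1, h2, h3, hc⟩ | ⟨h1, h2, h3, hc⟩ | ⟨h1, h2, h3, hc⟩ |
    ⟨h1, h2, h3, hc⟩ | ⟨h1, h2, h3, hc⟩ | ⟨h1, h2, h3, hc⟩ <;> simp_all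

/-- `{P₁ ≁ c, c ≁ P₃}` is codes `{3, 7}`. [this work] -/
theorem mem_e1c_e2c_iff (hP : P₃ ⊆ P₃') (K : Finset (Sym2 V)) :
    K ∈ (gconn {c} P₁)ᶜ ∩ (gconn {c} P₃)ᶜ ↔ codeA c P₁ P₃ P₃' K ∈ ({3, 7} : Finset ℕ) := by
  rcases codeA_cases c P₁ P₃ P₃' hP K with ⟨h1, h2, h3, hc⟩ | ⟨h1, h2, h3, hc⟩ | ⟨h1, h2, h3, hc⟩ | ⟨h1, h2, h3, hc⟩ |
    ⟨h1, h2, h3, hc⟩ | ⟨h1, h2, h3, hc⟩ | ⟨h1, h2, h3, hc⟩ <;> simp_all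

/-- `{P₁ ≁ P₃′, P₁ ≁ c}` is codes `{5, 7}`. [this work] -/
theorem mem_e3c_e1c_iff (hP : P₃ ⊆ P₃') (K : Finset (Sym2 V)) :
    K ∈ (gconn P₃' P₁)ᶜ ∩ (gconn {c} P₁)ᶜ ↔ codeA c P₁ P₃ P₃' K ∈ ({5, 7} : Finset ℕ) := by
  rcases codeA_cases c P₁ P₃ P₃' hP K with ⟨h1, h2, h3, hc⟩ | ⟨h1, h2, h3, hc⟩ | ⟨h1, h2, h3, hc⟩ | ⟨h1, h2, h3, hc⟩ |
    ⟨h1, h2, h3, hc⟩ | ⟨h1, h2, h3, hc⟩ | ⟨h1, h2, h3, hc⟩ <;> simp_all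

/-- The whole space is all codes `< 8`. [this work] -/
theorem mem_univ_iff (hP : P₃ ⊆ P₃') (K : Finset (Sym2 V)) :
    K ∈ (Set.univ : Set (Finset (Sym2 V))) ↔ codeA c P₁ P₃ P₃' K ∈ (Finset.range 8 : Finset ℕ) := by
  rcases codeA_cases c P₁ P₃ P₃' hP K with ⟨h1, h2, h3, hc⟩ | ⟨h1, h2, h3, hc⟩ | ⟨h1, h2, h3, hc⟩ | ⟨h1, h2, h3, hc⟩ |
    ⟨h1, h2, h3, hc⟩ | ⟨h1, h2, h3, hc⟩ | ⟨h1, h2, h3, hc⟩ <;> simp_all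

end Events

/-- The unswitched potential as an integer table on code triples (the seven terms of `gcertU`). [this work] -/
def glamZ (l0 l1 l2 : ℕ) : ℤ :=
  chiN {4, 6} l0 * chiN {1, 3, 5, 7} l1 * chiN {0, 1, 4, 5} l2
  + chiN {4, 5} l0 * chiN {0, 2, 4, 6} l1 * chiN {2, 3, 6, 7} l2
  - chiN {7} l0 * chiN {1, 3, 5, 7} l1 * chiN {2, 3, 6, 7} l2
  - chiN (Finset.range 8) l0 * chiN {7} l1 * chiN {0, 1, 4, 5} l2
  - chiN (Finset.range 8) l0 * chiN {0, 2, 4, 6} l1 * chiN {7} l2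
  + chiN (Finset.range 8) l0 * chiN {4, 6} l1 * chiN {3, 7} l2
  + chiN (Finset.range 8) l0 * chiN {5, 7} l1 * chiN {3, 7} l2

omit [DecidableEq V] in
/-- The unswitched potential is a function of the three codes: `Λ(x) = glamZ (codeA x₀) (codeA x₁) (codeA x₂)`. [this work] -/
theorem gcertU_eq (hP : P₃ ⊆ P₃') (x : Fin 3 → Finset (Sym2 V)) :
    gcertU c P₁ P₃ P₃' x =
      (glamZ (codeA c P₁ P₃ P₃' (x 0)) (codeA c P₁ P₃ P₃' (x 1)) (codeA c P₁ P₃ P₃' (x 2)) : ℝ) := by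
  simp only [gcertU, ind_box, ind_eq_chiN (mem_e1_e3c_iff c P₁ P₃ P₃' hP), ind_eq_chiN (mem_e1c_iff c P₁ P₃ P₃' hP),
    ind_eq_chiN (mem_e2_iff c P₁ P₃ P₃' hP), ind_eq_chiN (mem_e2_e3c_iff c P₁ P₃ P₃' hP), ind_eq_chiN (mem_e1_iff c P₁ P₃ P₃' hP),
    ind_eq_chiN (mem_e2c_iff c P₁ P₃ P₃' hP), ind_eq_chiN (mem_q_iff c P₁ P₃ P₃' hP), ind_eq_chiN (mem_e1c_e2c_iff c P₁ P₃ P₃' hP),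
    ind_eq_chiN (mem_e3c_e1c_iff c P₁ P₃ P₃' hP), ind_eq_chiN (mem_univ_iff c P₁ P₃ P₃' hP), glamZ]
  push_cast
  ring

omit [DecidableEq V] in
/-- Codes are `< 8`. [this work] -/
theorem codeA_lt (K : Finset (Sym2 V)) : codeA c P₁ P₃ P₃' K < 8 := by
  unfold codeA; split_ifs <;> norm_num

omit [DecidableEq V] in
/-- Code `4` does not occur when `P₃ ⊆ P₃′`. [this work] -/
theorem codeA_ne_four (hP : P₃ ⊆ P₃') (K : Finset (Sym2 V)) : codeA c P₁ P₃ P₃' K ≠ 4 := by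
  rcases codeA_cases c P₁ P₃ P₃' hP K with ⟨h1, h2, h3, hc⟩ | ⟨h1, h2, h3, hc⟩ | ⟨h1, h2, h3, hc⟩ | ⟨h1, h2, h3, hc⟩ |
    ⟨h1, h2, h3, hc⟩ | ⟨h1, h2, h3, hc⟩ | ⟨h1, h2, h3, hc⟩ <;> simp_all

end Codes

end FibreHybridE3

end Summit.CriticalPhenomena.PercolationContinuityZ3.Theorems

end
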